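import Mathlib
import Summits.ValiantsHypothesis.ValiantsHypothesis.Theorems.BarrierLeverPartitionMinorsHitByVPHiddenStatesCoreLift
import Summits.ValiantsHypothesis.ValiantsHypothesis.Theorems.BarrierLeverPartitionMinorsHitByVPHiddenStatesHubWide

/-!
# Route BarrierLever — item `PartitionMinorsHitByVP` (stmt-ValiantsHypothesis-19717), line `hidden-states`:
# THE CORE LIFT, CELLS — the lower node at `(h, 2^h − c)` for every `h ≥ 18` and every `c ≤ 19`

Helper file (`--supports stmt-ValiantsHypothesis-19717`; cell valiant-natproofs, rung V4, 𝒟-side door (c), registered line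
`Cruxes/PartitionMinorsHitByVP/Lines/hidden_states.lean` v7; prover seat val-np-p6 gen 12). Definition-free; closes NO item.
Sequel of `…HiddenStatesCoreLift` (`CoreLift.universalJoinWideLower_lift`: a lower cell `(h, 2^h − c)` lifts to `(h+1, 2^{h+1} − c)`
whenever `c ≤ h + 1`).

* `universalJoinWideLower_lift_iter` — the lift iterated `d` times (`c ≤ h₀ + 1`, `c ≤ 2^{h₀}`).
* **`universalJoinWideLower_coTop_nineteen`** — with `HubWide.universalJoinWide_upto_eighteen` (p609852; ALL `u`, every `r`, `h ≤ 18`)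
  as the base: the body of `LowerNode.Stmt.universalJoinWideLower` (p599518) holds at `(h, 2^h − c)` for EVERY `h ≥ 18` and EVERY
  `c ≤ 19` — a uniform top window of twenty sizes (the flag cells of p622861 give `c ≤ d + 1`, `2^d ≤ (h+d)(h³+1)`, i.e. `c ≤ 18` at
  `h = 19` and `c ≤ 19` only from `h = 20` on).
* `universalJoinWideLower_nineteen_coTop'` — `h = 19`: every `r ≥ 2^19 − 19 = 524 269`. With the hub joins below (p611381,
  `r ≤ 517 158`) the open LOWER window at `h = 19` becomes `517 159 ≤ r ≤ 524 268` (7 110 sizes).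

WHAT THIS IS NOT: one more size at `h = 19`; nothing at co-size `c ≥ 20`, nothing in the bulk; no stub of the line is closed;
nothing on crux 14610 or VP ≠ VNP.
-/

set_option linter.dupNamespace false

namespace Summit.ValiantsHypothesis.ValiantsHypothesis.Theorems.BarrierLever.HiddenStates

open Finset Matrix MvPolynomial

noncomputable section

namespace CoreLift

/-- **Iterated core lift.** The lower node body at `(h₀, 2^{h₀} − c)` gives the body at `(h₀ + d, 2^{h₀+d} − c)` for every `d`,
provided `c ≤ h₀ + 1` and `c ≤ 2^{h₀}`. -/
theorem universalJoinWideLower_lift_iter (h₀ c : ℕ) (hch : c ≤ h₀ + 1) (hc2 : c ≤ 2 ^ h₀)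
    (H : ∃ (m K : ℕ) (W : Fin m → ℕ) (wt : Fin m → Fin K → ℕ) (e : Fin (2 ^ h₀ - c) → Fin m × Finset (Fin K)),
      m ≤ h₀ + h₀ ∧ K ≤ h₀ * h₀ * h₀ ∧ Function.Injective e ∧
      (∀ x : Fin m × Finset (Fin K), x ∉ Set.range e →
        ∀ i, W (e i).1 + ∑ k ∈ (e i).2, wt (e i).1 k < W x.1 + ∑ k ∈ x.2, wt x.1 k) ∧
      ∀ u : Fin (2 ^ h₀ - c) → Finset (Fin h₀), Function.Injective u → IsLowerSet (Set.range u) →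
        ∃ tx : Fin m → Option (Fin K) → Fin h₀ → ℂ,
          (Matrix.of fun i k : Fin (2 ^ h₀ - c) =>
            ∏ a ∈ u i, (tx (e k).1 none a + ∑ q ∈ (e k).2, tx (e k).1 (some q) a)).det ≠ 0) (d : ℕ) :
    ∃ (m K : ℕ) (W : Fin m → ℕ) (wt : Fin m → Fin K → ℕ) (e : Fin (2 ^ (h₀ + d) - c) → Fin m × Finset (Fin K)),
      m ≤ (h₀ + d) + (h₀ + d) ∧ K ≤ (h₀ + d) * (h₀ + d) * (h₀ + d) ∧ Function.Injective e ∧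
      (∀ x : Fin m × Finset (Fin K), x ∉ Set.range e →
        ∀ i, W (e i).1 + ∑ k ∈ (e i).2, wt (e i).1 k < W x.1 + ∑ k ∈ x.2, wt x.1 k) ∧
      ∀ u : Fin (2 ^ (h₀ + d) - c) → Finset (Fin (h₀ + d)), Function.Injective u → IsLowerSet (Set.range u) →
        ∃ tx : Fin m → Option (Fin K) → Fin (h₀ + d) → ℂ,
          (Matrix.of fun i k : Fin (2 ^ (h₀ + d) - c) =>
            ∏ a ∈ u i, (tx (e k).1 none a + ∑ q ∈ (e k).2, tx (e k).1 (some q) a)).det ≠ 0 := by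
  induction d with
  | zero => simpa using H
  | succ d ih =>
    have hpow : 2 ^ h₀ ≤ 2 ^ (h₀ + d) := Nat.pow_le_pow_right (by norm_num) (by omega)
    exact universalJoinWideLower_lift (h₀ + d) c (by omega) (le_trans hc2 hpow) ih

/-- **THE LOWER NODE AT THE TOP TWENTY SIZES OF EVERY `h ≥ 18`.** For `18 ≤ h` and `c ≤ 19` the body of
`LowerNode.Stmt.universalJoinWideLower` holds at `(h, 2^h − c)`: lift the `h = 18` designs of `HubWide.universalJoinWide_upto_eighteen`
(all `u`, all `r`) along a core coordinate, `h − 18` times. -/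
theorem universalJoinWideLower_coTop_nineteen (h c : ℕ) (h18 : 18 ≤ h) (hc : c ≤ 19) :
    ∃ (m K : ℕ) (W : Fin m → ℕ) (wt : Fin m → Fin K → ℕ) (e : Fin (2 ^ h - c) → Fin m × Finset (Fin K)),
      m ≤ h + h ∧ K ≤ h * h * h ∧ Function.Injective e ∧
      (∀ x : Fin m × Finset (Fin K), x ∉ Set.range e →
        ∀ i, W (e i).1 + ∑ k ∈ (e i).2, wt (e i).1 k < W x.1 + ∑ k ∈ x.2, wt x.1 k) ∧
      ∀ u : Fin (2 ^ h - c) → Finset (Fin h), Function.Injective u → IsLowerSet (Set.range u) →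
        ∃ tx : Fin m → Option (Fin K) → Fin h → ℂ,
          (Matrix.of fun i k : Fin (2 ^ h - c) =>
            ∏ a ∈ u i, (tx (e k).1 none a + ∑ q ∈ (e k).2, tx (e k).1 (some q) a)).det ≠ 0 := by
  obtain ⟨d, rfl⟩ : ∃ d, h = 18 + d := ⟨h - 18, by omega⟩
  refine universalJoinWideLower_lift_iter 18 c (by omega) (by norm_num; omega) ?_ d
  obtain ⟨m, K, W, wt, e, hm, hK, he, hthr, hgood⟩ :=
    HubWide.universalJoinWide_upto_eighteen 18 (by norm_num) le_rfl (2 ^ 18 - c) (Nat.sub_le _ _)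
  exact ⟨m, K, W, wt, e, hm, hK, he, hthr, fun u hu _ => hgood u hu⟩

/-- **`h = 19`: the lower node for every `r ≥ 2^19 − 19 = 524 269`** (stated by co-size `c ≤ 19`). With the hub joins below
(`HubWide.universalJoinWideLower_nineteen`, `r ≤ 517 158`) the open LOWER window at `h = 19` is `517 159 ≤ r ≤ 524 268`. -/
theorem universalJoinWideLower_nineteen_coTop' (c : ℕ) (hc : c ≤ 19) :
    ∃ (m K : ℕ) (W : Fin m → ℕ) (wt : Fin m → Fin K → ℕ) (e : Fin (2 ^ 19 - c) → Fin m × Finset (Fin K)),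
      m ≤ 19 + 19 ∧ K ≤ 19 * 19 * 19 ∧ Function.Injective e ∧
      (∀ x : Fin m × Finset (Fin K), x ∉ Set.range e →
        ∀ i, W (e i).1 + ∑ k ∈ (e i).2, wt (e i).1 k < W x.1 + ∑ k ∈ x.2, wt x.1 k) ∧
      ∀ u : Fin (2 ^ 19 - c) → Finset (Fin 19), Function.Injective u → IsLowerSet (Set.range u) →
        ∃ tx : Fin m → Option (Fin K) → Fin 19 → ℂ,
          (Matrix.of fun i k : Fin (2 ^ 19 - c) =>
            ∏ a ∈ u i, (tx (e k).1 none a + ∑ q ∈ (e k).2, tx (e k).1 (some q) a)).det ≠ 0 :=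
  universalJoinWideLower_coTop_nineteen 19 c (by norm_num) hc

/-- The arithmetic of the `h = 19` window after this file: `2^19 − 19 = 524 269`, one below the flag cells' `524 270`. -/
theorem lower_window_nineteen' : 2 ^ 19 - 19 = 524269 ∧ 2 ^ 19 - 18 = 524270 := by norm_num

end CoreLift

end

end Summit.ValiantsHypothesis.ValiantsHypothesis.Theorems.BarrierLever.HiddenStates
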